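import Summits.Ventures.PercRepro.Night2ShadowForm

/-!
# PercRepro — a dependent set has fewer coloops than its rank (night-2, gen 6)

`Night2ShadowForm.lean` records `card_coloops_le`: a set of rank `u` has at most `u` coloops.  This file sharpens it
for DEPENDENT loopless sets: if `S` has rank `u`, more than `u` elements and no loops, then `S` has at most `u − 1`
coloops (**`card_coloops_add_one_le_of_lt_card`**).  Proof: `u` coloops would form a basis `K` of `S`; an element
`e ∈ S ∖ K` lies in the closure of a minimal sub-family `K' ⊆ K` (nonempty, as `e` is not a loop), and the exchange
property puts every `k ∈ K'` into the closure of `S ∖ {k}` — so `k` is not a coloop.  This is the coloop count used by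
the fractional matchings of the local form at `q = 2` (`proofs/NIGHT-2-local.md` §8, the regime `d = 1`): a shadow set
with a «hull» member below it is dependent, hence has at most `q` covering preimages.
-/

namespace PercRepro.Shadow

open Finset PerFlat ThmH

variable {α : Type*} [DecidableEq α] {M : Matroid α} [M.Finite]

/-- The coloops of `S` lie in `S`. -/
theorem coloops_subset (S : Finset α) : coloops M S ⊆ S := Finset.filter_subset _ _

omit [DecidableEq α] in
/-- A subset of `S` of the same rank as `S` spans `S`. -/
theorem subset_closure_of_eRk_eq {S K : Finset α} (hS : S ⊆ gr M) (hK : K ⊆ S)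
    (hr : M.eRk (K : Set α) = M.eRk (S : Set α)) : (S : Set α) ⊆ M.closure (K : Set α) := by
  intro e he
  by_contra hecl
  have heE : e ∈ M.E \ M.closure (K : Set α) := ⟨by rw [← coe_gr]; exact_mod_cast hS he, hecl⟩
  have h1 : M.eRk (insert e (K : Set α)) = M.eRk (K : Set α) + 1 := Matroid.eRk_insert_eq_add_one heE
  have h2 : M.eRk (insert e (K : Set α)) ≤ M.eRk (S : Set α) :=
    M.eRk_mono (Set.insert_subset (by exact_mod_cast he) (by exact_mod_cast hK))
  rw [h1, ← hr] at h2
  have hfin : M.eRk (K : Set α) ≠ ⊤ := by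
    have h3 : M.eRk (K : Set α) ≤ ((K.card : ℕ) : ℕ∞) := by
      have := M.eRk_le_encard (K : Set α)
      rwa [Set.encard_coe_eq_coe_finsetCard] at this
    exact ne_top_of_le_ne_top (ENat.coe_ne_top _) h3
  obtain ⟨n, hn⟩ := ENat.ne_top_iff_exists.1 hfin
  rw [← hn] at h2
  have h4 : n + 1 ≤ n := by exact_mod_cast h2
  omega

/-- **A dependent loopless set of rank `u` has at most `u − 1` coloops.** -/
theorem card_coloops_add_one_le_of_lt_card {S : Finset α} (hS : S ⊆ gr M) {u : ℕ}
    (hu : M.eRk (S : Set α) = (u : ℕ∞)) (hloop : ∀ e ∈ S, M.Indep ({e} : Set α)) (hdep : u < S.card) :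
    (coloops M S).card + 1 ≤ u := by
  classical
  by_contra hlt
  have hle := card_coloops_le hS hu
  have hKcard : (coloops M S).card = u := by omega
  set K := coloops M S with hKdef
  have hKS : K ⊆ S := coloops_subset S
  have hKind : M.Indep (K : Set α) := indep_coloops hS
  have hKr : M.eRk (K : Set α) = (u : ℕ∞) := by
    rw [hKind.eRk_eq_encard, Set.encard_coe_eq_coe_finsetCard, hKcard]
  have hspan : (S : Set α) ⊆ M.closure (K : Set α) := subset_closure_of_eRk_eq hS hKS (by rw [hKr, hu])
  -- an element of S outside K
  have hne : ¬ S ⊆ K := fun h => by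
    have := Finset.card_le_card h
    omega
  obtain ⟨e, heS, heK⟩ := Finset.not_subset.1 hne
  have hecl : e ∈ M.closure (K : Set α) := hspan (by exact_mod_cast heS)
  -- e is not a loop: e ∉ closure ∅
  have henl : e ∉ M.closure (∅ : Set α) := by
    intro h
    have h1 : M.eRk ({e} : Set α) ≤ M.eRk (M.closure (∅ : Set α)) :=
      M.eRk_mono (Set.singleton_subset_iff.2 h)
    rw [M.eRk_closure_eq, Matroid.eRk_empty] at h1
    have h2 : M.eRk ({e} : Set α) = 1 := by
      rw [(hloop e heS).eRk_eq_encard, Set.encard_singleton]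
    rw [h2] at h1
    exact absurd h1 (by decide)
  -- a minimal subfamily K' ⊆ K with e ∈ closure K'
  set 𝒦 : Finset (Finset α) := K.powerset.filter (fun K' => e ∈ M.closure (K' : Set α)) with h𝒦
  have h𝒦ne : 𝒦.Nonempty := ⟨K, by rw [h𝒦, Finset.mem_filter, Finset.mem_powerset]; exact ⟨le_rfl, hecl⟩⟩
  obtain ⟨K', hK'mem, hK'min⟩ := Finset.exists_min_image 𝒦 Finset.card h𝒦ne
  rw [h𝒦, Finset.mem_filter, Finset.mem_powerset] at hK'mem
  obtain ⟨hK'K, heK'⟩ := hK'mem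
  -- K' is nonempty
  obtain ⟨k, hk⟩ : K'.Nonempty := by
    rw [Finset.nonempty_iff_ne_empty]
    rintro rfl
    exact henl (by simpa using heK')
  -- e ∉ closure (K' ∖ k) by minimality
  have hnot : e ∉ M.closure ((K'.erase k : Finset α) : Set α) := by
    intro h
    have hmem : K'.erase k ∈ 𝒦 := by
      rw [h𝒦, Finset.mem_filter, Finset.mem_powerset]
      exact ⟨(Finset.erase_subset _ _).trans hK'K, h⟩
    have := hK'min _ hmem
    rw [Finset.card_erase_of_mem hk] at this
    have hpos : 0 < K'.card := Finset.card_pos.2 ⟨k, hk⟩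
    omega
  -- exchange: k ∈ closure (insert e (K' ∖ k))
  have hk' : k ∈ M.closure (insert e ((K'.erase k : Finset α) : Set α)) := by
    apply Matroid.mem_closure_insert hnot
    have : insert k ((K'.erase k : Finset α) : Set α) = (K' : Set α) := by
      rw [← Finset.coe_insert, Finset.insert_erase hk]
    rw [this]
    exact heK'
  -- hence k ∈ closure (S ∖ k): k is not a coloop
  have hkK : k ∈ K := hK'K hk
  have hkcol : k ∈ coloops M S := hkK
  rw [mem_coloops] at hkcol
  apply hkcol.2
  rw [← Finset.mem_coe, coe_clF]
  have hsub : insert e ((K'.erase k : Finset α) : Set α) ⊆ ((S.erase k : Finset α) : Set α) := by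
    intro x hx
    rw [Set.mem_insert_iff] at hx
    rw [Finset.coe_erase]
    rcases hx with rfl | hx
    · exact ⟨heS, fun h => heK (h ▸ hkK)⟩
    · rw [Finset.coe_erase] at hx
      exact ⟨hKS (hK'K hx.1), hx.2⟩
  exact M.closure_subset_closure hsub hk'

end PercRepro.Shadow
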